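import Mathlib
import Summits.KontsevichZagierPeriods.Zeta5Search.ThirdOrderRaise
import Summits.KontsevichZagierPeriods.Zeta5Search.ThirdOrderCorrTwo
import Summits.KontsevichZagierPeriods.Zeta5Search.ThirdOrderShapes
import Summits.KontsevichZagierPeriods.Zeta5Search.SecondOrderLive
import HarnessLib

/-!
# ζ(5) search — the DOUBLY RAISED PAIR at first order: `σ(z) − σ(z̄) = c · τ(T)`, `c ∈ ℤ` (tools for THEOREM A⁗, P2)

Cell `pub-zeta5` (HONEST FRAMING: systematic search; no irrationality claim unless certified), typer seat generation 12.
REPORT-gen2-g10 §6.4 (P2): for a class `z` whose type list is an admissible double raise of the palindrome `T` (`isRaise2`,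
hypothesis (T3) of `LawA4`) and its conjugate `z̄` (type list reversed), `σ(z) − σ(z̄) = σ[(P_z − P_z^r)Φ_T] = c·τ(T)` with the
INTEGER `c = L−a−c'` (`T+δ_a+δ_c'`), `L+1−a` (`1::(T+δ_a)`), `−(a+1)` (`(T+δ_a)++[1]`), `L+2` (`2::T`), `−(L+2)` (`T++[2]`),
`0` (`1::(T++[1])`) (`live_pair_double`).  Inputs: the raise calculus at first and second order, the shapes `isRaise2_level`, and the
vanishing translation terms (`typeCorr_eq_zero_of_consClass`, `typeCorr2_eq_zero_of_consTwoClass`).  Nothing here bears on irrationality.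
-/

noncomputable section

open Finset PowerSeries

namespace Summit.KontsevichZagierPeriods.Zeta5Search.SecondOrder

open Summit.KontsevichZagierPeriods.Zeta5Search.CasoratianValuation (InPolytope)
open Summit.KontsevichZagierPeriods.Zeta5Search.ClusterValuation
open Summit.KontsevichZagierPeriods.Zeta5Search.LevelClass (typeRho typeW typeV typeExp classSet_level level_injective level_mem
  classPoles_level typeW_congr typeV_congr)
open Summit.KontsevichZagierPeriods.Zeta5Search.CellKit (conj_level netExp_conj_level)

variable {p : ℕ} [hp : Fact p.Prime]

/-! ## §1 Reversal of the six shapes over a palindrome -/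

section Rev

variable {L : ℕ} {e : ℕ → ℤ} (hpal : ∀ k ≤ L, e (L - k) = e k)
include hpal

omit hp in
/-- Reversal of `T+δ_a+δ_c`. -/
theorem rev_raiseAt_raiseAt {a c j : ℕ} (ha : a ≤ L) (hc : c ≤ L) (hj : j ≤ L) :
    raiseAt (raiseAt e a) c (L - j) = raiseAt (raiseAt e (L - a)) (L - c) j := by
  have h1 : e (L - j) = e j := hpal j hj
  simp only [raiseAt]
  split_ifs <;> omega

omit hp in
/-- Reversal of `1 :: (T+δ_a)`. -/
theorem rev_consOne_raiseAt {a j : ℕ} (ha : a ≤ L) (hj : j ≤ L + 1) :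
    consOne (raiseAt e a) (L + 1 - j) = snocOne (raiseAt e (L - a)) L j := by
  have h2 : j ≤ L → e (L + 1 - j - 1) = e j := fun h => by
    rw [show L + 1 - j - 1 = L - j by omega]; exact hpal j h
  simp only [raiseAt, consOne, snocOne]
  split_ifs <;> omega

omit hp in
/-- Reversal of `(T+δ_a) ++ [1]`. -/
theorem rev_snocOne_raiseAt {a j : ℕ} (ha : a ≤ L) (hj : j ≤ L + 1) :
    snocOne (raiseAt e a) L (L + 1 - j) = consOne (raiseAt e (L - a)) j := by
  have h2 : 1 ≤ j → e (L + 1 - j) = e (j - 1) := fun h => by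
    rw [show L + 1 - j = L - (j - 1) by omega]; exact hpal (j - 1) (by omega)
  simp only [raiseAt, consOne, snocOne]
  split_ifs <;> omega

omit hp in
/-- Reversal of `2 :: T`. -/
theorem rev_consTwo {j : ℕ} (hj : j ≤ L + 1) :
    raiseAt (consOne e) 0 (L + 1 - j) = raiseAt (snocOne e L) (L + 1) j := by
  have h2 : j ≤ L → e (L + 1 - j - 1) = e j := fun h => by
    rw [show L + 1 - j - 1 = L - j by omega]; exact hpal j h
  simp only [raiseAt, consOne, snocOne]
  split_ifs <;> omega

omit hp in
/-- Reversal of `T ++ [2]`. -/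
theorem rev_snocTwo {j : ℕ} (hj : j ≤ L + 1) :
    raiseAt (snocOne e L) (L + 1) (L + 1 - j) = raiseAt (consOne e) 0 j := by
  have h2 : 1 ≤ j → e (L + 1 - j) = e (j - 1) := fun h => by
    rw [show L + 1 - j = L - (j - 1) by omega]; exact hpal (j - 1) (by omega)
  simp only [raiseAt, consOne, snocOne]
  split_ifs <;> omega

omit hp in
/-- `1 :: (T ++ [1])` is a palindrome. -/
theorem rev_consSnoc {j : ℕ} (hj : j ≤ L + 1 + 1) :
    consOne (snocOne e L) (L + 1 + 1 - j) = consOne (snocOne e L) j := by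
  have h2 : 1 ≤ j → j ≤ L + 1 → e (L + 1 + 1 - j - 1) = e (j - 1) := fun h h' => by
    rw [show L + 1 + 1 - j - 1 = L - (j - 1) by omega]; exact hpal (j - 1) (by omega)
  simp only [consOne, snocOne]
  split_ifs <;> omega

end Rev

/-! ## §2 The doubly raised pair -/

section Live

variable (b : ℕ → ℤ) (hb : InPolytope b) (hpn : (p : ℤ) ≤ b 0)
  {T : List ℤ} (hT : T.reverse = T) {z : ℕ} (hz : z < p) (hpole : 1 ≤ classPoleCount b p z) (hneg : classExp b p z < -1)
  (hcz : ¬ CentreIn b p z)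
include hb hpn hT hz hpole hneg hcz

/-- **DOUBLY RAISED PAIR, first order.**  If the type list of the pole class `z` (`E_z < −1`, not self-conjugate) is an admissible
double raise of the palindrome `T`, then `ŵ_z − ŵ_z̄ = c·τ_W(T)` and `v̂_z − v̂_z̄ = c·τ_V(T)` for an INTEGER `c`. -/
theorem live_pair_double (hr : isRaise2 T (classTypeList b p z) = true) :
    ∃ c : ℤ, wHat b p z - wHat b p (conjClass b p z) = (c : ℚ) * typeTauW (tTop T) (tList T) ∧
      vHat b p z - vHat b p (conjClass b p z) = (c : ℚ) * typeTauV (tTop T) (tList T) := by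
  have h0 : 0 ≤ b 0 := hb.1.1
  have hp0 : 0 < p := hp.out.pos
  have hzn := le_b0_of_lt b hpn hz
  obtain ⟨hL, hL'⟩ := level_bounds' (p := p) b hzn
  set M := topLevel b p z with hMdef
  set f : ℕ → ℤ := fun k => netExp b (z + k * p) with hfdef
  have hf : ∀ k ≤ M, netExp b (z + k * p) = f k := fun k _ => rfl
  have hpalT := tList_pal hT
  -- a pole among the levels
  have hfneg : ∃ i ≤ M, f i < 0 := by
    obtain ⟨q, hq⟩ := card_pos.1 (show 0 < ((classSet b p z).filter fun s => netExp b s < 0).card from hpole)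
    have hP : (classSet b p z).filter (fun s => netExp b s < 0) =
        ((range (M + 1)).filter fun k => f k < 0).image fun k => z + k * p := classPoles_level b hz hL hL' f hf
    rw [hP] at hq
    obtain ⟨k, hk, -⟩ := mem_image.1 hq
    obtain ⟨hkr, hkneg⟩ := mem_filter.1 hk
    exact ⟨k, by have := mem_range.1 hkr; omega, hkneg⟩
  -- the conjugate class
  obtain ⟨hz', hM2, hM2'⟩ := conj_level b hz hL hL'
  have hfc : ∀ k ≤ M, netExp b (conjClass b p z + k * p) = f (M - k) := fun k hk => netExp_conj_level b hL hL' h0 hk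
  have hc0 : ¬ (¬ (2 : ℤ) ∣ b 0 ∧ CentreIn b p z) := fun h => hcz h.2
  have hc0' : ¬ (¬ (2 : ℤ) ∣ b 0 ∧ CentreIn b p (conjClass b p z)) :=
    fun h => hcz ((centreIn_conj_iff b h0 hzn).1 h.2)
  have hnegc : classExp b p (conjClass b p z) < -1 := by rw [classExp_conj b h0 hzn]; exact hneg
  -- `T` is non-empty: the three shapes over `[]` have no pole
  have hTne : T ≠ [] := by
    rintro rfl
    rw [classTypeList_level b hL hL'] at hr
    obtain ⟨i, hi, hfi⟩ := hfneg
    have hmem : f i ∈ (List.range (M + 1)).map (fun k => netExp b (z + k * p)) :=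
      List.mem_map.2 ⟨i, List.mem_range.2 (by omega), rfl⟩
    unfold isRaise2 at hr
    simp only [List.length_nil, List.range_zero, List.any_nil, Bool.false_or, Bool.or_eq_true, beq_iff_eq,
      List.nil_append] at hr
    rcases hr with (hr | hr) | hr <;> { rw [hr] at hmem; simp at hmem; omega }
  rw [← range_map_tList hTne, classTypeList_level b hL hL'] at hr
  -- the functionals as type functionals
  have hw : wHat b p z = typeW M f := wHat_level₀ b hz hL hL' f hf hc0
  have hv : vHat b p z = typeV M f := vHat_level₀ b hz hL hL' f hf hc0
  have hwc : wHat b p (conjClass b p z) = typeW M (fun k => f (M - k)) := wHat_level₀ b hz' hM2 hM2' _ hfc hc0'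
  have hvc : vHat b p (conjClass b p z) = typeV M (fun k => f (M - k)) := vHat_level₀ b hz' hM2 hM2' _ hfc hc0'
  rw [hw, hv, hwc, hvc]
  set e := tList T with hedef
  set L := tTop T with hLTdef
  rcases isRaise2_level hr with ⟨a, ha, c, hc, hML, hfk⟩ | ⟨a, ha, hML, hfk⟩ | ⟨a, ha, hML, hfk⟩ | ⟨hML, hfk⟩ | ⟨hML, hfk⟩ |
    ⟨hML, hfk⟩
  · -- `T + δ_a + δ_c`
    have e1 : ∀ j ≤ M, f j = raiseAt (raiseAt e a) c j := fun j hj => hfk j (by omega)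
    have e2 : ∀ j ≤ M, f (M - j) = raiseAt (raiseAt e (L - a)) (L - c) j := by
      intro j hj
      show netExp b (z + (M - j) * p) = _
      rw [hfk (M - j) (by omega), hML]
      exact rev_raiseAt_raiseAt hpalT ha hc (by omega)
    refine ⟨(L : ℤ) - a - c, ?_, ?_⟩
    · rw [typeW_congr e1, typeW_congr e2, hML, typeW_raiseAt _ hc, typeW_raiseAt _ (by omega : L - c ≤ L),
        typeW2_raiseAt _ ha, typeW_raiseAt _ ha, typeW2_raiseAt _ (by omega : L - a ≤ L),
        typeW_raiseAt _ (by omega : L - a ≤ L), typeTauW]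
      push_cast [Nat.cast_sub ha, Nat.cast_sub hc]
      ring
    · rw [typeV_congr e1, typeV_congr e2, hML, typeV_raiseAt _ hc, typeV_raiseAt _ (by omega : L - c ≤ L),
        typeV2_raiseAt _ ha, typeV_raiseAt _ ha, typeV2_raiseAt _ (by omega : L - a ≤ L),
        typeV_raiseAt _ (by omega : L - a ≤ L), typeTauV]
      push_cast [Nat.cast_sub ha, Nat.cast_sub hc]
      ring
  · -- `1 :: (T + δ_a)`; the conjugate is `(T + δ_{L−a}) ++ [1]`
    have e1 : ∀ j ≤ M, f j = consOne (raiseAt e a) j := fun j hj => hfk j (by omega)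
    have e2 : ∀ j ≤ M, f (M - j) = snocOne (raiseAt e (L - a)) L j := by
      intro j hj
      show netExp b (z + (M - j) * p) = _
      rw [hfk (M - j) (by omega), hML]
      exact rev_consOne_raiseAt hpalT ha (by omega)
    have hcorr : typeCorr L (raiseAt e a) = 0 := by
      rw [hML] at hL hL'
      exact typeCorr_eq_zero_of_consClass b hz hL hL' (raiseAt e a) (fun i hi => hfk i hi) hc0 (by omega)
    refine ⟨(L : ℤ) + 1 - a, ?_, ?_⟩
    · rw [typeW_congr e1, typeW_congr e2, hML, typeW_consOne, typeW_snocOne, typeW2_raiseAt _ ha, typeW_raiseAt _ ha,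
        typeW2_raiseAt _ (by omega : L - a ≤ L), typeW_raiseAt _ (by omega : L - a ≤ L), typeTauW]
      push_cast [Nat.cast_sub ha]
      ring
    · rw [typeV_congr e1, typeV_congr e2, hML, typeV_consOne, typeV_snocOne, typeV2_raiseAt _ ha, typeV_raiseAt _ ha,
        typeV2_raiseAt _ (by omega : L - a ≤ L), typeV_raiseAt _ (by omega : L - a ≤ L), typeTauV, hcorr]
      push_cast [Nat.cast_sub ha]
      ring
  · -- `(T + δ_a) ++ [1]`; the conjugate is `1 :: (T + δ_{L−a})`
    have e1 : ∀ j ≤ M, f j = snocOne (raiseAt e a) L j := fun j hj => hfk j (by omega)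
    have e2 : ∀ j ≤ M, f (M - j) = consOne (raiseAt e (L - a)) j := by
      intro j hj
      show netExp b (z + (M - j) * p) = _
      rw [hfk (M - j) (by omega), hML]
      exact rev_snocOne_raiseAt hpalT ha (by omega)
    have hcorr : typeCorr L (raiseAt e (L - a)) = 0 := by
      rw [hML] at hM2 hM2'
      refine typeCorr_eq_zero_of_consClass b hz' hM2 hM2' (raiseAt e (L - a)) (fun i hi => ?_) hc0' (by omega)
      rw [hfc i (by omega)]; exact e2 i (by omega)
    refine ⟨-((a : ℤ) + 1), ?_, ?_⟩
    · rw [typeW_congr e1, typeW_congr e2, hML, typeW_consOne, typeW_snocOne, typeW2_raiseAt _ ha, typeW_raiseAt _ ha,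
        typeW2_raiseAt _ (by omega : L - a ≤ L), typeW_raiseAt _ (by omega : L - a ≤ L), typeTauW]
      push_cast [Nat.cast_sub ha]
      ring
    · rw [typeV_congr e1, typeV_congr e2, hML, typeV_consOne, typeV_snocOne, typeV2_raiseAt _ ha, typeV_raiseAt _ ha,
        typeV2_raiseAt _ (by omega : L - a ≤ L), typeV_raiseAt _ (by omega : L - a ≤ L), typeTauV, hcorr]
      push_cast [Nat.cast_sub ha]
      ring
  · -- `2 :: T`; the conjugate is `T ++ [2]`
    have e1 : ∀ j ≤ M, f j = raiseAt (consOne e) 0 j := fun j hj => hfk j (by omega)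
    have e2 : ∀ j ≤ M, f (M - j) = raiseAt (snocOne e L) (L + 1) j := by
      intro j hj
      show netExp b (z + (M - j) * p) = _
      rw [hfk (M - j) (by omega), hML]
      exact rev_consTwo hpalT (by omega)
    have hcorr2 : typeCorr2 L e = 0 := by
      rw [hML] at hL hL'
      exact typeCorr2_eq_zero_of_consTwoClass b hz hL hL' e (fun i hi => hfk i hi) hc0 (by omega)
    refine ⟨(L : ℤ) + 2, ?_, ?_⟩
    · rw [typeW_congr e1, typeW_congr e2, hML, typeW_raiseAt _ (Nat.zero_le _), typeW_raiseAt _ le_rfl, typeW2_consOne,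
        typeW2_snocOne, typeW_snocOne, typeTauW]
      push_cast
      ring
    · rw [typeV_congr e1, typeV_congr e2, hML, typeV_raiseAt _ (Nat.zero_le _), typeV_raiseAt _ le_rfl, typeV2_consOne,
        typeV2_snocOne, typeV_snocOne, typeTauV, hcorr2]
      push_cast
      ring
  · -- `T ++ [2]`; the conjugate is `2 :: T`
    have e1 : ∀ j ≤ M, f j = raiseAt (snocOne e L) (L + 1) j := fun j hj => hfk j (by omega)
    have e2 : ∀ j ≤ M, f (M - j) = raiseAt (consOne e) 0 j := by
      intro j hj
      show netExp b (z + (M - j) * p) = _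
      rw [hfk (M - j) (by omega), hML]
      exact rev_snocTwo hpalT (by omega)
    have hcorr2 : typeCorr2 L e = 0 := by
      rw [hML] at hM2 hM2'
      refine typeCorr2_eq_zero_of_consTwoClass b hz' hM2 hM2' e (fun i hi => ?_) hc0' (by omega)
      rw [hfc i (by omega)]; exact e2 i (by omega)
    refine ⟨-((L : ℤ) + 2), ?_, ?_⟩
    · rw [typeW_congr e1, typeW_congr e2, hML, typeW_raiseAt _ (Nat.zero_le _), typeW_raiseAt _ le_rfl, typeW2_consOne,
        typeW2_snocOne, typeW_snocOne, typeTauW]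
      push_cast
      ring
    · rw [typeV_congr e1, typeV_congr e2, hML, typeV_raiseAt _ (Nat.zero_le _), typeV_raiseAt _ le_rfl, typeV2_consOne,
        typeV2_snocOne, typeV_snocOne, typeTauV, hcorr2]
      push_cast
      ring
  · -- `1 :: (T ++ [1])`: a palindrome, the conjugate has the same levels
    have e2 : ∀ j ≤ M, f (M - j) = f j := by
      intro j hj
      show netExp b (z + (M - j) * p) = netExp b (z + j * p)
      rw [hfk (M - j) (by omega), hfk j (by omega), hML]
      exact rev_consSnoc hpalT (by omega)
    refine ⟨0, ?_, ?_⟩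
    · rw [typeW_congr e2]; push_cast; ring
    · rw [typeV_congr e2]; push_cast; ring

end Live

end Summit.KontsevichZagierPeriods.Zeta5Search.SecondOrder

end
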